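import Summits.QuantumFields.YangMills.Theorems.UnitScaleTiltFluctuationComparisonRegPrIntLOnChi
import Summits.QuantumFields.YangMills.Theorems.UnitScaleTiltInteriorExcisionInner
import Summits.QuantumFields.YangMills.Theorems.UnitScaleTiltFluctuationComparisonRegPrOneStepSubmersion
import HarnessLib

/-!
# `UnitScaleTiltFluctuationComparisonRegPrIntLOnChiV3` — THE §2 TEMPLATE: the record-free engine `InteriorExcision.regPrIntL_of_dataOnPrintChi` INSTANTIATED AT TODAY'S
# v3 RECORD — «STUB 1 ∧ (Thm 1 ∧ (8)) ∧ 2′ ∧ 3⁗ ∧ (i*) ⟹ FluctuationComparisonRegPrIntL» THROUGH PRINT'S χ OF THE DATUM'S MINIMISER (stmt-QuantumFields-20520; width-lever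
# lane `ym-ust-19935-r1` g3, «(R1) print's χ of [Balaban1985UV3] (47) back»)

Count-neutral helper (`--supports stmt-QuantumFields-20520`); registry untouched; no numerics; every [Balaban1985UV3]/[King1986]/[Balaban1985Variational] row is a
hypothesis (the registered stub texts of skeleton v5k VERBATIM) or a landed theorem of the tree.

WHAT THIS FILE IS.  The v5kC skeleton of the R-57χ repair (OWNER RULING g23-№2 + ADD. 6) will carry the one-token successors 2′χ / 3⁗χ / (i*)χ of today's stubs over the
definer's re-typed record (`OfV3chiAt`, `PkgAtV3chi`, `dataOfV3chi`).  Its §2 is `…IntLOnChi.regPrIntL_of_dataOnPrintChi` fed by a datum-level adapter.  This file writes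
that adapter AGAINST TODAY'S RECORD — `dataOnPrintChi_of_v3Stubs : 2′ → 3⁗ → (i*) → hData` — and the capstone `regPrIntL_of_v3Stubs_viaPrintChi`, so that (1) the engine's
interface is checked by the kernel to be instantiable from the record's by-name API (`AlphaInputsT3AC.dataOfV3_uminTriv`, `repAtHeights_dataOfV3`,
`LogComparisonAlphaAdapter.exists_gamma_thresholds`, S-E″ `GlobalSlack.levelCauchyOfGlobalSupRateTSlack_dec`, χ-S-E″ `PrintChi.levelCauchyOnOfGlobalSupRateTSlackOn_dec`),
and (2) the v5kC port is literally three token swaps in THIS proof: `PkgAtV3 ↦ PkgAtV3chi`, `dataOfV3 ↦ dataOfV3chi`, and the one line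
`twoSidedRepOn_of_repAt _ (repAtHeights_dataOfV3 …)` ↦ the re-typed record's (A)-on-χ (`LogComparisonRepAtHeightsOn.twoSidedRepOn_of_oneStepTrivOn_printChi` over
`dataOfV3chi`'s rows).  Today's (A) is the FULL-window `RepAtHeights` (row R3D-02, refuted at `L ∈ {3,5}` — F-r1-g2-1), which implies the χ-restricted one
(`PrintChi.twoSidedRepOn_of_repAt`); the composition below never reads it off χ.

DIFFERENCE FROM SKELETON v5k's §2.  v5k discharges only the `ChiGood(μ_L)` guards of (i*) (stub T, ∃-form of [Balaban1985Variational] Thm 1); reading (A) on print's χ OF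
THE DATUM'S OWN MINIMISER needs Thm 1's (8)-clause for EVERY minimiser at block-size level (`MinimisersIn8At`; see `…IntLOnChi` §3 and `thm1In8_of_attained_of_in8`): the
hypothesis `hT8` below replaces T — same source (crux `MinimiserStabilityRegPr`'s `variational_of_leaves_log`), one more conjunct displayed.

References: T. Bałaban, CMP 102 (1985) 255–275 [Balaban1985UV3] ((41) p.266, (47) p.267, Thm 2 p.272); CMP 102 (1985) 277–309 [Balaban1985Variational] (Thm 1 (8)
p.279, Prop 8 p.304); C. King, CMP 102 (1986) 649–677 [King1986] (Thm 3.4 (3.9) p.656, Props 3.8–3.9 pp.664–665); T. Bałaban, CMP 109 (1987) 249–301 [Balaban1987RG1]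
((0.4) p.253).
-/

set_option autoImplicit false

noncomputable section

namespace Summit.QuantumFields.YangMills.Theorems.InteriorExcision

open MeasureTheory Filter
open Literature.MathematicalPhysics.QuantumFieldTheory.Balaban1983to89
open Literature.MathematicalPhysics.QuantumFieldTheory.Balaban1983to89.T3ContinuumYM3Torus
open Literature.MathematicalPhysics.QuantumFieldTheory.Balaban1983to89.T3LevelShift
open Literature.MathematicalPhysics.QuantumFieldTheory.Balaban1983to89.T3UnitLawDensityEML (ℰp measurableE_ℰp)
open Literature.MathematicalPhysics.QuantumFieldTheory.Balaban1983to89.T3UnitScaleTilt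
open Literature.MathematicalPhysics.QuantumFieldTheory.Balaban1983to89.T3TiltDescent
open Literature.MathematicalPhysics.QuantumFieldTheory.Balaban1983to89.T3RegularMinimiser
open Literature.MathematicalPhysics.QuantumFieldTheory.Balaban1983to89.T3PrintedRegularMinimiser
open Literature.MathematicalPhysics.QuantumFieldTheory.Balaban1983to89.T3PrintedMinimiserExistence
open Literature.MathematicalPhysics.QuantumFieldTheory.Balaban1983to89.T3SmallLiftHistory
open Literature.MathematicalPhysics.QuantumFieldTheory.Balaban1983to89.T3LogComparisonSocket
open Literature.MathematicalPhysics.QuantumFieldTheory.Balaban1983to89.T3AlphaInputsAC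
open Literature.MathematicalPhysics.QuantumFieldTheory.Balaban1983to89.T3LowerAlongMinimisersSplit (MinimisersIn8At)
open Literature.MathematicalPhysics.QuantumFieldTheory.Balaban1983to89.T3InteriorExcision
open Literature.MathematicalPhysics.QuantumFieldTheory.Balaban1983to89.Missing
open Summit.QuantumFields.YangMills.Theorems.PrintChi
open Summit.QuantumFields.YangMills.Theorems.GlobalSlack
open Summit.QuantumFields.YangMills.Theorems.LogComparisonRepAtHeightsOn (atHeights printChiSets)

/-! ## §1 The datum at one block size from 2′(L) and the FULL-window slack row 3⁗(L) (the `L ≥ 7` currency) -/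

/-- **THE DATUM-LEVEL TRIPLE AT ONE BLOCK SIZE from 2′(L) and the full-window slack row of 3⁗ at `L`**: record `𝔠` with `(𝔠.b₀, 𝔠.p₀) = (b₀, p₀)`, exponent `a` and
the package family of 3⁗, S-E″ `levelCauchyOfGlobalSupRateTSlack_dec` (⇒ `m₀`, full `CauchyAtHeights`, restricted to the χ-good data by `pintCauchyOn_of_cauchyAt`), the [7]
thresholds `exists_gamma_thresholds`; the datum is `dataOfV3 p π`, (a) by `dataOfV3_uminTriv`, (b) by `repAtHeights_dataOfV3` weakened to print's χ (`twoSidedRepOn_of_repAt`).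
[cite: King1986, Thm 3.4 (3.9) p.656; Balaban1985UV3, (41) p.266 and (47) p.267] -/
theorem dataOnPrintChiAt_of_laneRecords_slack (L : ℕ) (hLo : Odd L) (hL : 1 < L)
    (h2 : Summit.QuantumFields.YangMills.Theorems.AlphaInputsT3ACv3Rec L)
    (h3 : ∀ (𝔠 : Summit.QuantumFields.Balaban3D.Proofs.Primitives.AlphaConsts L (Summit.QuantumFields.Balaban3D.Carriers.suGroupModel 2).N)
      (a₀ a₁ : ℝ), 0 < a₀ → 0 < a₁ → 𝔠.B₃ * a₁ ≤ a₀ →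
      ∃ a : ℝ, 0 < a ∧ ∃ γB : ℝ, 0 < γB ∧ ∀ (F : T3Family) (γ : ℝ) (hF : F.L = L) (hγ : 0 < γ), γ ≤ γB →
        ∀ (hγ1 : γ ≤ (min (hF ▸ 𝔠).gamma0 1) ^ 2),
          Summit.QuantumFields.YangMills.Theorems.AlphaInputsT3AC.OfV3At F (hF ▸ 𝔠) a₀ a₁ →
          ∃ (p : ∀ K, Summit.QuantumFields.YangMills.Theorems.AlphaInputsT3AC.PkgAtV3 F (hF ▸ 𝔠) γ hγ hγ1 K),
            (∀ K, (p K).a₀ = a₀ ∧ (p K).a₁ = a₁) ∧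
            ∃ (π : Summit.QuantumFields.YangMills.Theorems.AlphaInputsT3AC.PolymerT3 F) (σ : ℕ) (C : ℝ), 7 ≤ σ ∧ 0 ≤ C ∧
              GlobalSupRateTSlack (Summit.QuantumFields.YangMills.Theorems.AlphaInputsT3AC.dataOfV3 p π) (hF ▸ 𝔠).b₀ (hF ▸ 𝔠).p₀ a σ C) :
    ∃ (b₁ p₁ : ℝ), ∀ (b₀ p₀ : ℝ), b₁ ≤ b₀ → p₁ ≤ p₀ → 0 < b₀ → 2 < p₀ →
      ∃ ε₁ : ℝ, 0 < ε₁ ∧ ∀ (ε₀ : ℝ), 0 < ε₀ → ε₀ ≤ ε₁ → ∃ m₀ : ℕ, ∀ (m : ℕ), m₀ ≤ m →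
        ∃ γ₁ : ℝ, 0 < γ₁ ∧ ∀ (F : T3Family) (γ : ℝ), F.L = L → 0 < γ → γ ≤ γ₁ →
          ∃ D : AlphaDataT3 F γ,
            (∀ (K n : ℕ) (hnK : n < K) (V : GaugeField (F.P n) 0 (Matrix.specialUnitaryGroup (Fin 2) ℂ)),
              PlaqSmall (θBal F.L γ b₀ p₀ n) V →
                D.Umin K (K - n) (D.triv K (K - n))
                    (fieldShift (F.sitesPerDir_eq (m := F.m) (K := K) (j := K - n) (m' := F.m) (K' := n) (j' := 0) (by omega)) V) ∈
                  regFibrePr F n K hnK.le ε₀ V ∧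
                wilsonAction4 (D.Umin K (K - n) (D.triv K (K - n))
                    (fieldShift (F.sitesPerDir_eq (m := F.m) (K := K) (j := K - n) (m' := F.m) (K' := n) (j' := 0) (by omega)) V)) =
                  minActionRegPr F n K hnK.le ε₀ V) ∧
            TwoSidedRepOn F γ b₀ p₀ (atHeights (printChiSets D b₀ p₀)) ε₀ D.PintH D.EcstH D.RmH ∧
            PintCauchyOn F γ b₀ p₀
              (fun K n h V => ChiGood F γ b₀ p₀ ε₀ (1 - 2 / ((F.L : ℝ) * Real.sqrt F.L)) (n := n) (K := K) h V) m D.PintH := by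
  obtain ⟨b₁, p₁, hrec⟩ := h2
  refine ⟨b₁, p₁, fun b₀ p₀ hb1 hp1 hb hp => ?_⟩
  obtain ⟨𝔠, a₀, a₁, hcb, hcp, ha0, ha1, hw, h𝔠⟩ := hrec b₀ p₀ hb1 hp1
  subst hcb
  subst hcp
  obtain ⟨a, ha, γB, hγB, hBC⟩ := h3 𝔠 a₀ a₁ ha0 ha1 hw
  obtain ⟨εs, hεs, hS⟩ := levelCauchyOfGlobalSupRateTSlack_dec L hLo hL a ha
  refine ⟨min a₀ εs, lt_min ha0 hεs, fun ε₀ h0 h1 => ?_⟩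
  have h1a : ε₀ ≤ a₀ := h1.trans (min_le_left _ _)
  have h1s : ε₀ ≤ εs := h1.trans (min_le_right _ _)
  obtain ⟨m₀, hm₀⟩ := hS ε₀ h0 h1s
  refine ⟨m₀, fun m hm => ?_⟩
  obtain ⟨γT, hγT, -, hT⟩ := Summit.QuantumFields.YangMills.Theorems.LogComparisonAlphaAdapter.exists_gamma_thresholds
    (B₃ := 𝔠.B₃) 𝔠.b₀_pos 𝔠.p₀_pos ha1 𝔠.B₃_pos.le h0
  have hg0 : 0 < (min 𝔠.gamma0 1) ^ 2 := pow_pos (lt_min 𝔠.gamma0_pos one_pos) 2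
  obtain ⟨γs, hγs, hS'⟩ := hm₀ m hm 𝔠.b₀ 𝔠.p₀ hb hp
  refine ⟨min (min γB (min γT ((min 𝔠.gamma0 1) ^ 2))) γs,
    lt_min (lt_min hγB (lt_min hγT hg0)) hγs, fun F γ hF hγ hγ₁ => ?_⟩
  subst hF
  have hγB' : γ ≤ γB := hγ₁.trans ((min_le_left _ _).trans (min_le_left _ _))
  have hγT' : γ ≤ γT := hγ₁.trans ((min_le_left _ _).trans ((min_le_right _ _).trans (min_le_left _ _)))
  have hγ1 : γ ≤ (min 𝔠.gamma0 1) ^ 2 := hγ₁.trans ((min_le_left _ _).trans ((min_le_right _ _).trans (min_le_right _ _)))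
  have hγs' : γ ≤ γs := hγ₁.trans (min_le_right _ _)
  obtain ⟨p, hp', π, σ, C, hσ, hC0, hG⟩ := hBC F γ rfl hγ hγB' hγ1 (h𝔠 F rfl)
  obtain ⟨hT1, hT2, hT3⟩ := hT F.L F.hL.2.le γ hγ hγT'
  refine ⟨Summit.QuantumFields.YangMills.Theorems.AlphaInputsT3AC.dataOfV3 p π, fun K n hnK V hV => ?_, ?_, ?_⟩
  · exact Summit.QuantumFields.YangMills.Theorems.AlphaInputsT3AC.dataOfV3_uminTriv p π K n hnK ε₀
      (by rw [(hp' K).2]; exact hT1 n) (hT2 n) (by rw [(hp' K).1]; exact h1a) V hV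
  · exact twoSidedRepOn_of_repAt _
      (Summit.QuantumFields.YangMills.Theorems.AlphaInputsT3AC.repAtHeights_dataOfV3 p π hp' ε₀ h0 h1a hT1 hT2 hT3)
  · exact pintCauchyOn_of_cauchyAt _
      (hS' F γ rfl hγ hγs' (Summit.QuantumFields.YangMills.Theorems.AlphaInputsT3AC.dataOfV3 p π) σ C hσ hC0 hG)

/-! ## §2 The datum at one block size from 2′(L) and the slack row ON χ-good data, (i*) at `(L, μ_L)` (the `L < 7` currency) -/

/-- **THE DATUM-LEVEL TRIPLE AT ONE BLOCK SIZE from 2′(L) and King's slack row read on the doubly-`ChiGood(μ_L)`-good data** ((i*) at margin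
`μ_L = 1 − 2/(L√L)`): as §1 with the χ-restricted S-E″ `levelCauchyOnOfGlobalSupRateTSlackOn_dec` in place of S-E″. [cite: King1986, Thm 3.4 (3.9) p.656; Balaban1985UV3, (47) p.267] -/
theorem dataOnPrintChiAt_of_laneRecords_slackOnChi (L : ℕ) (hLo : Odd L) (hL : 1 < L)
    (h2 : Summit.QuantumFields.YangMills.Theorems.AlphaInputsT3ACv3Rec L)
    (hIμ :
      ∀ (𝔠 : Summit.QuantumFields.Balaban3D.Proofs.Primitives.AlphaConsts L (Summit.QuantumFields.Balaban3D.Carriers.suGroupModel 2).N)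
        (a₀ a₁ : ℝ), 0 < a₀ → 0 < a₁ → 𝔠.B₃ * a₁ ≤ a₀ →
        ∃ a : ℝ, 0 < a ∧ ∃ γB : ℝ, 0 < γB ∧ ∀ (F : T3Family) (γ : ℝ) (hF : F.L = L) (hγ : 0 < γ), γ ≤ γB →
          ∀ (hγ1 : γ ≤ (min (hF ▸ 𝔠).gamma0 1) ^ 2),
            Summit.QuantumFields.YangMills.Theorems.AlphaInputsT3AC.OfV3At F (hF ▸ 𝔠) a₀ a₁ →
            ∃ (p : ∀ K, Summit.QuantumFields.YangMills.Theorems.AlphaInputsT3AC.PkgAtV3 F (hF ▸ 𝔠) γ hγ hγ1 K),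
              (∀ K, (p K).a₀ = a₀ ∧ (p K).a₁ = a₁) ∧
              ∃ (π : Summit.QuantumFields.YangMills.Theorems.AlphaInputsT3AC.PolymerT3 F) (σ : ℕ) (C : ℝ), 7 ≤ σ ∧ 0 ≤ C ∧
                ∀ ε₀ : ℝ, 0 < ε₀ → ε₀ ≤ a₀ →
                  GlobalSupRateTSlackOn
                    (fun K n h V => ChiGood F γ (hF ▸ 𝔠).b₀ (hF ▸ 𝔠).p₀ ε₀ (1 - 2 / ((L : ℝ) * Real.sqrt L)) (n := n) (K := K) h V)
                    (Summit.QuantumFields.YangMills.Theorems.AlphaInputsT3AC.dataOfV3 p π) (hF ▸ 𝔠).b₀ (hF ▸ 𝔠).p₀ a σ C) :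
    ∃ (b₁ p₁ : ℝ), ∀ (b₀ p₀ : ℝ), b₁ ≤ b₀ → p₁ ≤ p₀ → 0 < b₀ → 2 < p₀ →
      ∃ ε₁ : ℝ, 0 < ε₁ ∧ ∀ (ε₀ : ℝ), 0 < ε₀ → ε₀ ≤ ε₁ → ∃ m₀ : ℕ, ∀ (m : ℕ), m₀ ≤ m →
        ∃ γ₁ : ℝ, 0 < γ₁ ∧ ∀ (F : T3Family) (γ : ℝ), F.L = L → 0 < γ → γ ≤ γ₁ →
          ∃ D : AlphaDataT3 F γ,
            (∀ (K n : ℕ) (hnK : n < K) (V : GaugeField (F.P n) 0 (Matrix.specialUnitaryGroup (Fin 2) ℂ)),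
              PlaqSmall (θBal F.L γ b₀ p₀ n) V →
                D.Umin K (K - n) (D.triv K (K - n))
                    (fieldShift (F.sitesPerDir_eq (m := F.m) (K := K) (j := K - n) (m' := F.m) (K' := n) (j' := 0) (by omega)) V) ∈
                  regFibrePr F n K hnK.le ε₀ V ∧
                wilsonAction4 (D.Umin K (K - n) (D.triv K (K - n))
                    (fieldShift (F.sitesPerDir_eq (m := F.m) (K := K) (j := K - n) (m' := F.m) (K' := n) (j' := 0) (by omega)) V)) =
                  minActionRegPr F n K hnK.le ε₀ V) ∧
            TwoSidedRepOn F γ b₀ p₀ (atHeights (printChiSets D b₀ p₀)) ε₀ D.PintH D.EcstH D.RmH ∧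
            PintCauchyOn F γ b₀ p₀
              (fun K n h V => ChiGood F γ b₀ p₀ ε₀ (1 - 2 / ((F.L : ℝ) * Real.sqrt F.L)) (n := n) (K := K) h V) m D.PintH := by
  obtain ⟨b₁, p₁, hrec⟩ := h2
  refine ⟨b₁, p₁, fun b₀ p₀ hb1 hp1 hb hp => ?_⟩
  obtain ⟨𝔠, a₀, a₁, hcb, hcp, ha0, ha1, hw, h𝔠⟩ := hrec b₀ p₀ hb1 hp1
  subst hcb
  subst hcp
  obtain ⟨a, ha, γB, hγB, hBC⟩ := hIμ 𝔠 a₀ a₁ ha0 ha1 hw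
  obtain ⟨εs, hεs, hS⟩ := levelCauchyOnOfGlobalSupRateTSlackOn_dec L hLo hL a ha
  refine ⟨min a₀ εs, lt_min ha0 hεs, fun ε₀ h0 h1 => ?_⟩
  have h1a : ε₀ ≤ a₀ := h1.trans (min_le_left _ _)
  have h1s : ε₀ ≤ εs := h1.trans (min_le_right _ _)
  obtain ⟨m₀, hm₀⟩ := hS ε₀ h0 h1s
  refine ⟨m₀, fun m hm => ?_⟩
  obtain ⟨γT, hγT, -, hT⟩ := Summit.QuantumFields.YangMills.Theorems.LogComparisonAlphaAdapter.exists_gamma_thresholds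
    (B₃ := 𝔠.B₃) 𝔠.b₀_pos 𝔠.p₀_pos ha1 𝔠.B₃_pos.le h0
  have hg0 : 0 < (min 𝔠.gamma0 1) ^ 2 := pow_pos (lt_min 𝔠.gamma0_pos one_pos) 2
  obtain ⟨γs, hγs, hS'⟩ := hm₀ m hm 𝔠.b₀ 𝔠.p₀ hb hp
  refine ⟨min (min γB (min γT ((min 𝔠.gamma0 1) ^ 2))) γs,
    lt_min (lt_min hγB (lt_min hγT hg0)) hγs, fun F γ hF hγ hγ₁ => ?_⟩
  subst hF
  have hγB' : γ ≤ γB := hγ₁.trans ((min_le_left _ _).trans (min_le_left _ _))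
  have hγT' : γ ≤ γT := hγ₁.trans ((min_le_left _ _).trans ((min_le_right _ _).trans (min_le_left _ _)))
  have hγ1 : γ ≤ (min 𝔠.gamma0 1) ^ 2 := hγ₁.trans ((min_le_left _ _).trans ((min_le_right _ _).trans (min_le_right _ _)))
  have hγs' : γ ≤ γs := hγ₁.trans (min_le_right _ _)
  obtain ⟨p, hp', π, σ, C, hσ, hC0, hG⟩ := hBC F γ rfl hγ hγB' hγ1 (h𝔠 F rfl)
  obtain ⟨hT1, hT2, hT3⟩ := hT F.L F.hL.2.le γ hγ hγT'
  refine ⟨Summit.QuantumFields.YangMills.Theorems.AlphaInputsT3AC.dataOfV3 p π, fun K n hnK V hV => ?_, ?_, ?_⟩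
  · exact Summit.QuantumFields.YangMills.Theorems.AlphaInputsT3AC.dataOfV3_uminTriv p π K n hnK ε₀
      (by rw [(hp' K).2]; exact hT1 n) (hT2 n) (by rw [(hp' K).1]; exact h1a) V hV
  · exact twoSidedRepOn_of_repAt _
      (Summit.QuantumFields.YangMills.Theorems.AlphaInputsT3AC.repAtHeights_dataOfV3 p π hp' ε₀ h0 h1a hT1 hT2 hT3)
  · exact hS' F γ rfl hγ hγs' _ (Summit.QuantumFields.YangMills.Theorems.AlphaInputsT3AC.dataOfV3 p π) σ C hσ hC0 (hG ε₀ h0 h1a)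

/-! ## §3 Every odd block size: 2′ ∧ 3⁗ (`L ≥ 7`) ∧ (i*) (`L < 7`) ⟹ the engine's `hData` -/

/-- **THE ENGINE'S DATUM-LEVEL HYPOTHESIS `hData` FROM TODAY'S THREE REGISTERED STUBS** (texts of skeleton v5k verbatim): 2′ `stub_laneRecordsV3`, 3⁗
`stub_globalTwoRunSlackFam` (`L ≥ 7`, §1) and (i*) `stub_smallBlocksSlackOnChiAll` (odd `L < 7`, at margin `μ_L ∈ (0,1)` by `muL_pos_lt_one`, §2).
[cite: King1986, Thm 3.4 (3.9) p.656; Balaban1985UV3, (41) p.266 and (47) p.267] -/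
theorem dataOnPrintChi_of_v3Stubs
    (h2 : ∀ L : ℕ, Odd L → 1 < L → Summit.QuantumFields.YangMills.Theorems.AlphaInputsT3ACv3Rec L)
    (h3 : ∀ (L : ℕ), Odd L → 7 ≤ L → ∀ (𝔠 : Summit.QuantumFields.Balaban3D.Proofs.Primitives.AlphaConsts L (Summit.QuantumFields.Balaban3D.Carriers.suGroupModel 2).N)
      (a₀ a₁ : ℝ), 0 < a₀ → 0 < a₁ → 𝔠.B₃ * a₁ ≤ a₀ →
      ∃ a : ℝ, 0 < a ∧ ∃ γB : ℝ, 0 < γB ∧ ∀ (F : T3Family) (γ : ℝ) (hF : F.L = L) (hγ : 0 < γ), γ ≤ γB →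
        ∀ (hγ1 : γ ≤ (min (hF ▸ 𝔠).gamma0 1) ^ 2),
          Summit.QuantumFields.YangMills.Theorems.AlphaInputsT3AC.OfV3At F (hF ▸ 𝔠) a₀ a₁ →
          ∃ (p : ∀ K, Summit.QuantumFields.YangMills.Theorems.AlphaInputsT3AC.PkgAtV3 F (hF ▸ 𝔠) γ hγ hγ1 K),
            (∀ K, (p K).a₀ = a₀ ∧ (p K).a₁ = a₁) ∧
            ∃ (π : Summit.QuantumFields.YangMills.Theorems.AlphaInputsT3AC.PolymerT3 F) (σ : ℕ) (C : ℝ), 7 ≤ σ ∧ 0 ≤ C ∧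
              GlobalSupRateTSlack (Summit.QuantumFields.YangMills.Theorems.AlphaInputsT3AC.dataOfV3 p π) (hF ▸ 𝔠).b₀ (hF ▸ 𝔠).p₀ a σ C)
    (hI : ∀ (L : ℕ), Odd L → 1 < L → L < 7 → ∀ (μ : ℝ), 0 < μ → μ < 1 →
      ∀ (𝔠 : Summit.QuantumFields.Balaban3D.Proofs.Primitives.AlphaConsts L (Summit.QuantumFields.Balaban3D.Carriers.suGroupModel 2).N)
        (a₀ a₁ : ℝ), 0 < a₀ → 0 < a₁ → 𝔠.B₃ * a₁ ≤ a₀ →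
        ∃ a : ℝ, 0 < a ∧ ∃ γB : ℝ, 0 < γB ∧ ∀ (F : T3Family) (γ : ℝ) (hF : F.L = L) (hγ : 0 < γ), γ ≤ γB →
          ∀ (hγ1 : γ ≤ (min (hF ▸ 𝔠).gamma0 1) ^ 2),
            Summit.QuantumFields.YangMills.Theorems.AlphaInputsT3AC.OfV3At F (hF ▸ 𝔠) a₀ a₁ →
            ∃ (p : ∀ K, Summit.QuantumFields.YangMills.Theorems.AlphaInputsT3AC.PkgAtV3 F (hF ▸ 𝔠) γ hγ hγ1 K),
              (∀ K, (p K).a₀ = a₀ ∧ (p K).a₁ = a₁) ∧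
              ∃ (π : Summit.QuantumFields.YangMills.Theorems.AlphaInputsT3AC.PolymerT3 F) (σ : ℕ) (C : ℝ), 7 ≤ σ ∧ 0 ≤ C ∧
                ∀ ε₀ : ℝ, 0 < ε₀ → ε₀ ≤ a₀ →
                  GlobalSupRateTSlackOn (fun K n h V => ChiGood F γ (hF ▸ 𝔠).b₀ (hF ▸ 𝔠).p₀ ε₀ μ (n := n) (K := K) h V)
                    (Summit.QuantumFields.YangMills.Theorems.AlphaInputsT3AC.dataOfV3 p π) (hF ▸ 𝔠).b₀ (hF ▸ 𝔠).p₀ a σ C) :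
    ∀ L : ℕ, Odd L → 1 < L → ∃ (b₁ p₁ : ℝ), ∀ (b₀ p₀ : ℝ), b₁ ≤ b₀ → p₁ ≤ p₀ → 0 < b₀ → 2 < p₀ →
      ∃ ε₁ : ℝ, 0 < ε₁ ∧ ∀ (ε₀ : ℝ), 0 < ε₀ → ε₀ ≤ ε₁ → ∃ m₀ : ℕ, ∀ (m : ℕ), m₀ ≤ m →
        ∃ γ₁ : ℝ, 0 < γ₁ ∧ ∀ (F : T3Family) (γ : ℝ), F.L = L → 0 < γ → γ ≤ γ₁ →
          ∃ D : AlphaDataT3 F γ,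
            (∀ (K n : ℕ) (hnK : n < K) (V : GaugeField (F.P n) 0 (Matrix.specialUnitaryGroup (Fin 2) ℂ)),
              PlaqSmall (θBal F.L γ b₀ p₀ n) V →
                D.Umin K (K - n) (D.triv K (K - n))
                    (fieldShift (F.sitesPerDir_eq (m := F.m) (K := K) (j := K - n) (m' := F.m) (K' := n) (j' := 0) (by omega)) V) ∈
                  regFibrePr F n K hnK.le ε₀ V ∧
                wilsonAction4 (D.Umin K (K - n) (D.triv K (K - n))
                    (fieldShift (F.sitesPerDir_eq (m := F.m) (K := K) (j := K - n) (m' := F.m) (K' := n) (j' := 0) (by omega)) V)) =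
                  minActionRegPr F n K hnK.le ε₀ V) ∧
            TwoSidedRepOn F γ b₀ p₀ (atHeights (printChiSets D b₀ p₀)) ε₀ D.PintH D.EcstH D.RmH ∧
            PintCauchyOn F γ b₀ p₀
              (fun K n h V => ChiGood F γ b₀ p₀ ε₀ (1 - 2 / ((F.L : ℝ) * Real.sqrt F.L)) (n := n) (K := K) h V) m D.PintH := by
  intro L hLo hL
  by_cases h7 : 7 ≤ L
  · exact dataOnPrintChiAt_of_laneRecords_slack L hLo hL (h2 L hLo hL) (h3 L hLo h7)
  · have hμ := muL_pos_lt_one hL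
    exact dataOnPrintChiAt_of_laneRecords_slackOnChi L hLo hL (h2 L hLo hL)
      (fun 𝔠 a₀ a₁ ha0 ha1 hw => hI L hLo hL (not_le.mp h7) _ hμ.1 hμ.2 𝔠 a₀ a₁ ha0 ha1 hw)

/-! ## §4 The capstone: today's five inputs through print's χ -/

/-- **`FluctuationComparisonRegPrIntL ⇐ STUB 1 ∧ (Thm 1 ∧ (8), block-size level) ∧ 2′ ∧ 3⁗ ∧ (i*)` THROUGH PRINT'S χ OF THE DATUM'S MINIMISER** — skeleton v5k's
closure re-derived with the record-free engine `regPrIntL_of_dataOnPrintChi`: window positivity from STUB 1 (`OneStepSubmersion.posOnSmall_of_oneStepSmallLift`, p446430 ∘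
p490827), `hT8` in place of stub T (same source: crux `MinimiserStabilityRegPr`'s variational output, `thm1In8_of_attained_of_in8`), the datum by §3.  The v5kC version
is this proof with the re-typed record's names and its (A)-on-χ in §1/§2. [cite: Balaban1985UV3, (41) p.266 and (47) p.267; King1986, Prop. 3.8-3.9 pp.664-665] -/
theorem regPrIntL_of_v3Stubs_viaPrintChi
    (h1 : ∀ L : ℕ, ∃ κ δ₀ : ℝ, κ * Real.sqrt L ≤ 1 ∧ 0 < δ₀ ∧ ∀ F : T3Family, F.L = L → OneStepSmallLift F ℰp κ δ₀)
    (hT8 : ∀ L : ℕ, Odd L → 1 < L → ∃ a₀ a₁ B₃ : ℝ, 0 < a₀ ∧ 0 < a₁ ∧ 0 < B₃ ∧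
      Thm1GlobalMinAt L a₀ a₁ B₃ ∧ MinimisersIn8At L a₀ a₁ B₃)
    (h2 : ∀ L : ℕ, Odd L → 1 < L → Summit.QuantumFields.YangMills.Theorems.AlphaInputsT3ACv3Rec L)
    (h3 : ∀ (L : ℕ), Odd L → 7 ≤ L → ∀ (𝔠 : Summit.QuantumFields.Balaban3D.Proofs.Primitives.AlphaConsts L (Summit.QuantumFields.Balaban3D.Carriers.suGroupModel 2).N)
      (a₀ a₁ : ℝ), 0 < a₀ → 0 < a₁ → 𝔠.B₃ * a₁ ≤ a₀ →
      ∃ a : ℝ, 0 < a ∧ ∃ γB : ℝ, 0 < γB ∧ ∀ (F : T3Family) (γ : ℝ) (hF : F.L = L) (hγ : 0 < γ), γ ≤ γB →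
        ∀ (hγ1 : γ ≤ (min (hF ▸ 𝔠).gamma0 1) ^ 2),
          Summit.QuantumFields.YangMills.Theorems.AlphaInputsT3AC.OfV3At F (hF ▸ 𝔠) a₀ a₁ →
          ∃ (p : ∀ K, Summit.QuantumFields.YangMills.Theorems.AlphaInputsT3AC.PkgAtV3 F (hF ▸ 𝔠) γ hγ hγ1 K),
            (∀ K, (p K).a₀ = a₀ ∧ (p K).a₁ = a₁) ∧
            ∃ (π : Summit.QuantumFields.YangMills.Theorems.AlphaInputsT3AC.PolymerT3 F) (σ : ℕ) (C : ℝ), 7 ≤ σ ∧ 0 ≤ C ∧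
              GlobalSupRateTSlack (Summit.QuantumFields.YangMills.Theorems.AlphaInputsT3AC.dataOfV3 p π) (hF ▸ 𝔠).b₀ (hF ▸ 𝔠).p₀ a σ C)
    (hI : ∀ (L : ℕ), Odd L → 1 < L → L < 7 → ∀ (μ : ℝ), 0 < μ → μ < 1 →
      ∀ (𝔠 : Summit.QuantumFields.Balaban3D.Proofs.Primitives.AlphaConsts L (Summit.QuantumFields.Balaban3D.Carriers.suGroupModel 2).N)
        (a₀ a₁ : ℝ), 0 < a₀ → 0 < a₁ → 𝔠.B₃ * a₁ ≤ a₀ →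
        ∃ a : ℝ, 0 < a ∧ ∃ γB : ℝ, 0 < γB ∧ ∀ (F : T3Family) (γ : ℝ) (hF : F.L = L) (hγ : 0 < γ), γ ≤ γB →
          ∀ (hγ1 : γ ≤ (min (hF ▸ 𝔠).gamma0 1) ^ 2),
            Summit.QuantumFields.YangMills.Theorems.AlphaInputsT3AC.OfV3At F (hF ▸ 𝔠) a₀ a₁ →
            ∃ (p : ∀ K, Summit.QuantumFields.YangMills.Theorems.AlphaInputsT3AC.PkgAtV3 F (hF ▸ 𝔠) γ hγ hγ1 K),
              (∀ K, (p K).a₀ = a₀ ∧ (p K).a₁ = a₁) ∧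
              ∃ (π : Summit.QuantumFields.YangMills.Theorems.AlphaInputsT3AC.PolymerT3 F) (σ : ℕ) (C : ℝ), 7 ≤ σ ∧ 0 ≤ C ∧
                ∀ ε₀ : ℝ, 0 < ε₀ → ε₀ ≤ a₀ →
                  GlobalSupRateTSlackOn (fun K n h V => ChiGood F γ (hF ▸ 𝔠).b₀ (hF ▸ 𝔠).p₀ ε₀ μ (n := n) (K := K) h V)
                    (Summit.QuantumFields.YangMills.Theorems.AlphaInputsT3AC.dataOfV3 p π) (hF ▸ 𝔠).b₀ (hF ▸ 𝔠).p₀ a σ C) :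
    FluctuationComparisonRegPrIntL :=
  regPrIntL_of_dataOnPrintChi hT8 (dataOnPrintChi_of_v3Stubs h2 h3 hI)
    (Summit.QuantumFields.YangMills.Theorems.OneStepSubmersion.posOnSmall_of_oneStepSmallLift h1)

end Summit.QuantumFields.YangMills.Theorems.InteriorExcision

end
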